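import Summits.QuantumFields.YangMills.Theorems.UnitScaleGibbsMGFGronwall
import Summits.QuantumFields.YangMills.Theorems.UnitScaleGibbsMGFSecondMoment
import HarnessLib

/-!
# The weighted second moment straight from the two Schwinger–Dyson ∕ Grönwall differential inequalities — assembly of the LINE 28 candidate's two letter files

Crux of record `UnitScaleTilt.HistoryTailL` (stmt-QuantumFields-19936), cell `ym3-torus` (YM ladder rung R3 = continuum SU(2) Yang–Mills on T³ — a RUNG, NOT the
Clay problem); width seat `ym3-torus-px9` gen 9.  Pure real analysis ∕ measure theory; composes BY NAME the twin-width seat w8 g9's ✓`UnitScaleGibbsMGFGronwall`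
(§1 Grönwall with a linear rate `le_mul_exp_of_deriv_le_linear_mul`, §2 `hasDerivAt_integral_exp_mul_weight` ∕ `integral_exp_mul_weight_pos`) with this seat's
✓`UnitScaleGibbsMGFSecondMoment` (`integral_sq_mul_weight_le_of_subgaussian_mgf'` ∕ `…_nhds`), so that the OUTPUT SHAPE of the crux idea «gross-sd-transfer»'s stub S_SD
(LINE 28 candidate, `Cruxes/HistoryTailL/Ideas/gross-sd-transfer.md`, annexes 1–2) — the differential inequalities
`∫ (±X)·e^{s(±X)}·χ dμ ≤ (a·s + Δ)·∫ e^{s(±X)}·χ dμ` on `[0, t]` for the flux functional `X` AND its negative — feeds the second moment by ONE `exact`: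

* ★★★ `integral_sq_mul_weight_le_of_gronwall_two_sided` — `∫ X²·χ dμ ≤ (a + 2Δ∕t)·exp(a t²∕2 + Δ t)·∫χ dμ` (no positive-mass hypothesis: a null weight gives `0 ≤ 0`);
* ★★★ `integral_sq_mul_weight_le_of_gronwall_nhds` — DEFECT-FREE (`Δ = 0`) on `[0, T]`: `∫ X²·χ dμ ≤ a·∫χ dμ` — Gaussian domination of the weighted variance, the shape of
  «BlockSecondMomentL» (consumed Theorems-side by ✓`PoincareLipschitzMeanDeviationOfSecondMoment` and LEAD's K2-lane face v10 ✓`PoincareLipschitzHistoryTailOfSecondMoment`).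

THEOREMS ONLY (0 `def`, 0 `sorry`); `--supports stmt-QuantumFields-19936 --as helper`.  HONEST SCOPE: assembly of generic letters; the differential inequalities (the
content of S_SD ∕ S_dom — the Schwinger–Dyson identity ✓`UnitScaleGibbsOneBondSchwingerDyson(Matrix)` plus the line's covariant box Poincaré ∕ defect bounds) are
HYPOTHESES here; nothing of (Q), «BlockSecondMomentL», K1, `MeanDeviationL`, `HistoryTailL`, R3, d = 4, a continuum limit or a mass gap is proved; the Yang–Mills mass
gap is NOT proved.

References: L. Gross, Convergence of U(1)₃ lattice gauge theory to its continuum limit, CMP 92 (1983) 137–162, Thm 2.2 [GrossCMP1983]; S. Boucheron, G. Lugosi,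
P. Massart, Concentration Inequalities (2013), §2.2–§2.3 [BoucheronLugosiMassart2013].
-/

set_option autoImplicit false

noncomputable section

open MeasureTheory Set Filter Topology
open Summit.QuantumFields.YangMills.Theorems.UnitScaleGibbsMGFGronwall
  (le_mul_exp_of_deriv_le_linear_mul hasDerivAt_integral_exp_mul_weight integral_exp_mul_weight_pos)
open Summit.QuantumFields.YangMills.Theorems.UnitScaleGibbsMGFSecondMoment
  (integral_sq_mul_weight_le_of_subgaussian_mgf' integral_sq_mul_weight_le_of_subgaussian_mgf_nhds)

namespace Summit.QuantumFields.YangMills.Theorems.UnitScaleGibbsMGFSecondMomentOfGronwall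

variable {Ω : Type*} [MeasurableSpace Ω] (μ : Measure Ω) [IsFiniteMeasure μ]
variable {X χ : Ω → ℝ} {B M : ℝ}

/-- Grönwall on `[0, t]` for the weighted Laplace transform of a bounded measurable `Y` against a weight `0 ≤ χ ≤ M` of positive mass: the differential inequality
`∫ Y·e^{sY}·χ ≤ (a·s + Δ)·∫ e^{sY}·χ` on `[0, t]` gives `∫ e^{tY}·χ dμ ≤ (∫χ dμ)·exp(a t²∕2 + Δ t)` (w8 g9's §1 + §2 by name; `ψ(0) = ∫χ`). [cite: GrossCMP1983, Thm 2.2 (proof)] -/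
theorem integral_exp_mul_weight_le_of_gronwall {Y : Ω → ℝ} (hYm : Measurable Y) (hχm : Measurable χ)
    (hYB : ∀ ω, |Y ω| ≤ B) (hχ0 : ∀ ω, 0 ≤ χ ω) (hχM : ∀ ω, χ ω ≤ M) (hmass : 0 < ∫ ω, χ ω ∂μ) {a Δ t : ℝ} (ht : 0 ≤ t)
    (hineq : ∀ s ∈ Icc (0 : ℝ) t, ∫ ω, Y ω * Real.exp (s * Y ω) * χ ω ∂μ ≤ (a * s + Δ) * ∫ ω, Real.exp (s * Y ω) * χ ω ∂μ) :
    ∫ ω, Real.exp (t * Y ω) * χ ω ∂μ ≤ (∫ ω, χ ω ∂μ) * Real.exp (a * t ^ 2 / 2 + Δ * t) := by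
  have hχM' : ∀ ω, |χ ω| ≤ M := fun ω => by rw [abs_of_nonneg (hχ0 ω)]; exact hχM ω
  have hgron := le_mul_exp_of_deriv_le_linear_mul (ψ := fun s => ∫ ω, Real.exp (s * Y ω) * χ ω ∂μ)
    (ψ' := fun s => ∫ ω, Y ω * Real.exp (s * Y ω) * χ ω ∂μ) (a := a) (Δ := Δ) ht
    (fun s _ => hasDerivAt_integral_exp_mul_weight μ hYm hχm hYB hχM' s)
    (fun s _ => integral_exp_mul_weight_pos μ hYm hχm hYB hχM' hχ0 hmass s) hineq
  simpa only [zero_mul, Real.exp_zero, one_mul] using hgron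

/-- ★★★ **THE WEIGHTED SECOND MOMENT FROM THE TWO DIFFERENTIAL INEQUALITIES** (for `X` and for `−X` on `[0, t]`, `t > 0`, `a, Δ ≥ 0`):
`∫ X²·χ dμ ≤ (a + 2Δ∕t)·exp(a t²∕2 + Δ t)·∫χ dμ` — Grönwall twice (w8 g9's letters), then the `t`-point extraction `integral_sq_mul_weight_le_of_subgaussian_mgf'`; a weight of
zero mass gives `0 ≤ 0`. [cite: GrossCMP1983, Thm 2.2; BoucheronLugosiMassart2013, §2.3] -/
theorem integral_sq_mul_weight_le_of_gronwall_two_sided (hXm : Measurable X) (hχm : Measurable χ)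
    (hXB : ∀ ω, |X ω| ≤ B) (hχ0 : ∀ ω, 0 ≤ χ ω) (hχM : ∀ ω, χ ω ≤ M) {a Δ t : ℝ} (ht : 0 < t) (ha : 0 ≤ a) (hΔ : 0 ≤ Δ)
    (hp : ∀ s ∈ Icc (0 : ℝ) t, ∫ ω, X ω * Real.exp (s * X ω) * χ ω ∂μ ≤ (a * s + Δ) * ∫ ω, Real.exp (s * X ω) * χ ω ∂μ)
    (hm : ∀ s ∈ Icc (0 : ℝ) t, ∫ ω, (-X ω) * Real.exp (s * (-X ω)) * χ ω ∂μ ≤ (a * s + Δ) * ∫ ω, Real.exp (s * (-X ω)) * χ ω ∂μ) :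
    ∫ ω, X ω ^ 2 * χ ω ∂μ ≤ (a + 2 * Δ / t) * Real.exp (a * t ^ 2 / 2 + Δ * t) * ∫ ω, χ ω ∂μ := by
  have hχM' : ∀ ω, |χ ω| ≤ M := fun ω => by rw [abs_of_nonneg (hχ0 ω)]; exact hχM ω
  have hiχ : Integrable χ μ := (integrable_const M).mono' hχm.aestronglyMeasurable
    (ae_of_all _ fun ω => by rw [Real.norm_eq_abs]; exact hχM' ω)
  by_cases hmass : 0 < ∫ ω, χ ω ∂μ
  · have hXB' : ∀ ω, |(-X ω)| ≤ B := fun ω => by rw [abs_neg]; exact hXB ω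
    have hp' := integral_exp_mul_weight_le_of_gronwall μ hXm hχm hXB hχ0 hχM hmass ht.le hp
    have hm' := integral_exp_mul_weight_le_of_gronwall μ hXm.neg hχm hXB' hχ0 hχM hmass ht.le hm
    have hm'' : ∫ ω, Real.exp (-t * X ω) * χ ω ∂μ ≤ (∫ ω, χ ω ∂μ) * Real.exp (a * t ^ 2 / 2 + Δ * t) := by
      have : (fun ω => Real.exp (-t * X ω) * χ ω) = fun ω => Real.exp (t * (-X ω)) * χ ω := by
        funext ω; ring_nf
      rw [this]; exact hm'
    exact integral_sq_mul_weight_le_of_subgaussian_mgf' μ hXm hχm hXB hχ0 hχM ht ha hΔ hp' hm''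
  · -- zero mass: `χ = 0` a.e., both sides vanish
    have h0 : ∫ ω, χ ω ∂μ = 0 := le_antisymm (not_lt.mp hmass) (integral_nonneg hχ0)
    have hae : χ =ᵐ[μ] 0 := (integral_eq_zero_iff_of_nonneg (fun ω => hχ0 ω) hiχ).mp h0
    have hL : ∫ ω, X ω ^ 2 * χ ω ∂μ = 0 := by
      have : (fun ω => X ω ^ 2 * χ ω) =ᵐ[μ] 0 := by
        filter_upwards [hae] with ω hω
        simp [hω]
      rw [integral_congr_ae this]; simp
    rw [hL, h0, mul_zero]

/-- ★★★ **GAUSSIAN DOMINATION OF THE WEIGHTED VARIANCE FROM THE DEFECT-FREE DIFFERENTIAL INEQUALITIES** (`Δ = 0`, for `X` and `−X` on `[0, T]`, `T > 0`, `a ≥ 0`):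
`∫ X²·χ dμ ≤ a·∫χ dμ` — Grönwall on every `[0, t] ⊆ [0, T]`, then `t → 0⁺` (`integral_sq_mul_weight_le_of_subgaussian_mgf_nhds`).  The shape in which the LINE 28
candidate's S_SD ⟹ «BlockSecondMomentL» (`E_K[dist₁(Ū^j(∂a))²·χ_G] ≤ C·g²_{K−j}`). [cite: GrossCMP1983, Thm 2.2; BoucheronLugosiMassart2013, §2.3] -/
theorem integral_sq_mul_weight_le_of_gronwall_nhds (hXm : Measurable X) (hχm : Measurable χ)
    (hXB : ∀ ω, |X ω| ≤ B) (hχ0 : ∀ ω, 0 ≤ χ ω) (hχM : ∀ ω, χ ω ≤ M) {a T : ℝ} (hT : 0 < T) (ha : 0 ≤ a)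
    (hp : ∀ s ∈ Icc (0 : ℝ) T, ∫ ω, X ω * Real.exp (s * X ω) * χ ω ∂μ ≤ a * s * ∫ ω, Real.exp (s * X ω) * χ ω ∂μ)
    (hm : ∀ s ∈ Icc (0 : ℝ) T, ∫ ω, (-X ω) * Real.exp (s * (-X ω)) * χ ω ∂μ ≤ a * s * ∫ ω, Real.exp (s * (-X ω)) * χ ω ∂μ) :
    ∫ ω, X ω ^ 2 * χ ω ∂μ ≤ a * ∫ ω, χ ω ∂μ := by
  have hχM' : ∀ ω, |χ ω| ≤ M := fun ω => by rw [abs_of_nonneg (hχ0 ω)]; exact hχM ω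
  have hiχ : Integrable χ μ := (integrable_const M).mono' hχm.aestronglyMeasurable
    (ae_of_all _ fun ω => by rw [Real.norm_eq_abs]; exact hχM' ω)
  by_cases hmass : 0 < ∫ ω, χ ω ∂μ
  · have hXB' : ∀ ω, |(-X ω)| ≤ B := fun ω => by rw [abs_neg]; exact hXB ω
    -- Grönwall with `Δ = 0` on every `[0, t]`, `t ∈ (0, T]`
    have hpt : ∀ t ∈ Ioc (0 : ℝ) T, ∫ ω, Real.exp (t * X ω) * χ ω ∂μ ≤ (∫ ω, χ ω ∂μ) * Real.exp (a * t ^ 2 / 2) := by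
      intro t ht
      have hp0 : ∀ s ∈ Icc (0 : ℝ) t, ∫ ω, X ω * Real.exp (s * X ω) * χ ω ∂μ ≤ (a * s + 0) * ∫ ω, Real.exp (s * X ω) * χ ω ∂μ :=
        fun s hs => by simpa only [add_zero] using hp s ⟨hs.1, hs.2.trans ht.2⟩
      simpa only [zero_mul, add_zero] using integral_exp_mul_weight_le_of_gronwall μ hXm hχm hXB hχ0 hχM hmass ht.1.le hp0
    have hmt : ∀ t ∈ Ioc (0 : ℝ) T, ∫ ω, Real.exp (-t * X ω) * χ ω ∂μ ≤ (∫ ω, χ ω ∂μ) * Real.exp (a * t ^ 2 / 2) := by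
      intro t ht
      have hm0 : ∀ s ∈ Icc (0 : ℝ) t, ∫ ω, (-X ω) * Real.exp (s * (-X ω)) * χ ω ∂μ ≤ (a * s + 0) * ∫ ω, Real.exp (s * (-X ω)) * χ ω ∂μ :=
        fun s hs => by simpa only [add_zero] using hm s ⟨hs.1, hs.2.trans ht.2⟩
      have h := integral_exp_mul_weight_le_of_gronwall μ hXm.neg hχm hXB' hχ0 hχM hmass ht.1.le hm0
      have : (fun ω => Real.exp (-t * X ω) * χ ω) = fun ω => Real.exp (t * (-X ω)) * χ ω := by
        funext ω; ring_nf
      rw [this]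
      simpa only [zero_mul, add_zero, Pi.neg_apply] using h
    exact integral_sq_mul_weight_le_of_subgaussian_mgf_nhds μ hXm hχm hXB hχ0 hχM hT ha hpt hmt
  · have h0 : ∫ ω, χ ω ∂μ = 0 := le_antisymm (not_lt.mp hmass) (integral_nonneg hχ0)
    have hae : χ =ᵐ[μ] 0 := (integral_eq_zero_iff_of_nonneg (fun ω => hχ0 ω) hiχ).mp h0
    have hL : ∫ ω, X ω ^ 2 * χ ω ∂μ = 0 := by
      have : (fun ω => X ω ^ 2 * χ ω) =ᵐ[μ] 0 := by
        filter_upwards [hae] with ω hω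
        simp [hω]
      rw [integral_congr_ae this]; simp
    rw [hL, h0, mul_zero]

end Summit.QuantumFields.YangMills.Theorems.UnitScaleGibbsMGFSecondMomentOfGronwall

end
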